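import Mathlib
import Summits.ResolutionOfSingularities.ResolutionOfSingularities.Theorems.WeightedInvariantLocalWeightedDropNCResRegimeDefs
import Summits.ResolutionOfSingularities.ResolutionOfSingularities.Theorems.WeightedInvariantLocalWeightedDropTOT2NearSettingOld
import Summits.ResolutionOfSingularities.ResolutionOfSingularities.Theorems.WeightedInvariantLocalWeightedDropTOT2E1Decorated

/-!
# `LocalWeightedDrop`, TOT2-LINE inner S-ASM (3): DIRECTRIX TRANSPORT AT NEAR ANSWERS OF THE POINT MOVE (`Dir′ ⊇ V(s, ℓ̃)`), and the
# regime read-outs it forces — the letter regime (L) exits into itself or BAD position, the bad regime (B) exits into GOOD position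

Crux item stmt-ResolutionOfSingularities-8899 `WeightedInvariant.LocalWeightedDrop` (route `ResolutionOfSingularities/WeightedInvariant`), ENGINE
skeleton v32/v33, TOT2-LINE v1.3 §1 TRANSITIONS / §3 (L), (B) (`L/res-L1-w43-lead-1/g5/TOT2-LINE-v1.3.md`).  [OURS · L1 W4.3 · chain w43 · seat
res-L1-w43-lead-1 gen 5; def-free; on res-L1-w43-stub-3's near-point files (`TOT2Near.insertNth_inv_of_inv_cons_zero`,
`initEval_add_smul_eq_of_near`, `predAbove_succ_succAbove_succ`), res-L1-w43-stub-1's S-SET (`Decoration.transform`, `nearData_of_o_transform_eq`,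
`transform_f_eq_strict_of_o_transform_eq`), res-type-056's identity-move bookkeeping (`TOT2E1.strIdx_X`, `subst_X_fun`) and part (1)'s regime
vocabulary.  MODEL: Cossart–Jannsen–Saito LNM 2270 Thm 3.23 / (3.9) `IDir(x′) = ⟨Y′ + λW⟩` at very near points, hypersurface form; nothing here
is a statement of any manuscript; AI-produced, gate-checked, weaker than expert review.]

* `dotProduct_insertNth_zero`, `dotProduct_cons_zero`, `eq_zero_of_pow_add_eq` — bookkeeping;
* **`TOT2Near.tail_dirForm_of_near`** (bare germs, every dimension): at a NEAR answer `(c, i₀)` of the identity point blow-up of a germ with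
  `in_o f = λ·(ℓ·v)^o`, every form `L` with `in_o G′ = λ′·(L·w)^o` has TAIL PROPORTIONAL TO THE TRANSPORTED `ℓ`:
  `∃ κ ≠ 0, ∀ j, ℓ (i₀.succAbove j) = κ · L j.succ` — the new directrix plane contains the line `V(s, ℓ̃)`;
* `Decoration.dot_eq_zero_of_near` — at a same-order answer of the identity point move from a state with a directrix form, `ℓ · c = 0`;
* **`Decoration.tail_dirForm_transform`** — the decorated form (history `O = ∅`, answer with the same `o`);
* **`Decoration.letterDir_or_badDir_transform`** (L-exit) — from `LetterDir δ l`, a same-order answer with a directrix form `L` of the transform is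
  `LetterDir` (for the transformed letter) if `L 0 = 0` and `BadDir` otherwise;
* **`Decoration.goodDir_transform_of_leaving`** (B-exit) — from `O = ∅` with a directrix form `ℓ`, if some `l ∈ supp ℓ` LEAVES at a same-order answer
  (`c_l ≠ 0`) then any directrix form of the transform involves a non-letter: `GoodDir`;
* three-letter corollaries `…_or_hCol` using `Decoration.exists_isDirForm_of_not_hCol`.
-/

set_option linter.dupNamespace false -- mandated namespace of this single-conjunct summit

noncomputable section

namespace Summit.ResolutionOfSingularities.ResolutionOfSingularities.Theorems

open Literature.AlgebraicGeometry.Resolution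

/-! ## Bookkeeping on vectors -/

namespace TOT2Near

open MvPowerSeries TameFourTupleDrop

variable {k : Type} [Field k] {n : ℕ}

/-- `ℓ · (u′ with 0 inserted at i₀) = (ℓ ∘ succAbove i₀) · u′`. -/
theorem dotProduct_insertNth_zero (ℓ : Fin (n + 1) → k) (i₀ : Fin (n + 1)) (u' : Fin n → k) :
    dotProduct ℓ (Fin.insertNth i₀ (0 : k) u') = dotProduct (fun j => ℓ (i₀.succAbove j)) u' := by
  rw [dotProduct, dotProduct, Fin.sum_univ_succAbove _ i₀, Fin.insertNth_apply_same, mul_zero, zero_add]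
  refine Finset.sum_congr rfl fun j _ => ?_
  rw [Fin.insertNth_apply_succAbove]

/-- `L · (0, u′) = (L ∘ succ) · u′`. -/
theorem dotProduct_cons_zero (L : Fin (n + 1) → k) (u' : Fin n → k) :
    dotProduct L (Fin.cons (0 : k) u') = dotProduct (fun j => L j.succ) u' := by
  rw [dotProduct, dotProduct, Fin.sum_univ_succ, Fin.cons_zero, mul_zero, zero_add]
  refine Finset.sum_congr rfl fun j _ => ?_
  rw [Fin.cons_succ]

/-- If `λ·(a + t)^o = λ·a^o` for all `a`, `λ ≠ 0`, `o > 0`, then `t = 0`. -/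
theorem eq_zero_of_pow_add_eq {la t : k} (hla : la ≠ 0) {o : ℕ} (ho : 0 < o) (h : ∀ a : k, la * (a + t) ^ o = la * a ^ o) : t = 0 := by
  have h0 := h 0
  rw [zero_add, zero_pow ho.ne', mul_zero] at h0
  exact pow_eq_zero_iff ho.ne' |>.mp ((mul_eq_zero.mp h0).resolve_left hla)

/-- Two linear forms with nested kernels are proportional: if `L′ · u = 0 ⇒ ℓ″ · u = 0` then `ℓ″ = κ·L′`; if moreover `ℓ″ ≠ 0` then `κ ≠ 0`. -/
theorem exists_smul_of_ker_le {L' ℓ'' : Fin n → k} (h : ∀ u : Fin n → k, dotProduct L' u = 0 → dotProduct ℓ'' u = 0) (hℓ : ℓ'' ≠ 0) :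
    ∃ κ : k, κ ≠ 0 ∧ ∀ j, ℓ'' j = κ * L' j := by
  classical
  -- `L′ ≠ 0`
  obtain ⟨j₀, hj₀⟩ : ∃ j₀, L' j₀ ≠ 0 := by
    by_contra hall
    push Not at hall
    apply hℓ
    funext j
    have := h (Pi.single j 1) (by rw [dotProduct_single_one]; exact hall j)
    rwa [dotProduct_single_one] at this
  refine ⟨ℓ'' j₀ / L' j₀, ?_, fun j => ?_⟩
  · intro hκ
    rw [div_eq_zero_iff] at hκ
    rcases hκ with hκ | hκ
    · -- then every `ℓ″ j` vanishes
      apply hℓ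
      funext j
      have hu := h (Pi.single j (L' j₀) - Pi.single j₀ (L' j)) (by
        rw [dotProduct_sub, dotProduct_single, dotProduct_single, mul_comm]; ring)
      rw [dotProduct_sub, dotProduct_single, dotProduct_single, hκ, zero_mul, sub_zero] at hu
      exact (mul_eq_zero.mp hu).resolve_right hj₀
    · exact hj₀ hκ
  · have hu := h (Pi.single j (L' j₀) - Pi.single j₀ (L' j)) (by
      rw [dotProduct_sub, dotProduct_single, dotProduct_single, mul_comm]; ring)
    rw [dotProduct_sub, dotProduct_single, dotProduct_single, sub_eq_zero] at hu
    field_simp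
    linear_combination hu

/-! ## Directrix transport at a near answer of the point blow-up (bare germs, every dimension) -/

/-- **DIRECTRIX TRANSPORT.**  `f ∈ k⟦x₀,…,x_n⟧` with degree-`o` form `λ·(ℓ·v)^o` (`λ ≠ 0`, `ℓ ≠ 0`, `o > 0`: directrix plane `ℓ = 0`); point blow-up,
answer `c` with live slot `i₀`, `f(s(c+y)) = s^o·G`, NEAR successor `G′ = G|_{y_{i₀}=0}`.  If the successor's degree-`o` form is again of the shape
`λ′·(L·w)^o`, then the TAIL of `L` (its components on the letters `y_j`, `j ≠ i₀`, indexed by `succ`) is a non-zero multiple of the transported `ℓ`: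
`ℓ (i₀.succAbove j) = κ · L j.succ`.  (The vectors `(0,u′)` with `L·(0,u′) = 0` are invariance vectors of `in_o G′`, hence `u′♮ ∈ Dir(in_o f) = V(ℓ)` by
stub-3's (N2) lemma; two forms with nested kernels are proportional; `ℓ ∘ succAbove ≠ 0` because `c ∈ V(ℓ)` by (N1) and `c_{i₀} ≠ 0`.) -/
theorem tail_dirForm_of_near [Infinite k] (f : MvPowerSeries (Fin (n + 1)) k) (c : Fin (n + 1) → k) (i₀ : Fin (n + 1)) (hc : c i₀ ≠ 0)
    {o : ℕ} (ho : 0 < o) {G : MvPowerSeries (Fin (n + 1 + 1)) k}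
    (hfac : subst (CobordantChart.chart (fun _ : Fin (n + 1) => 1) c) f = X 0 ^ o * G)
    (hnear : (o : ℕ∞) ≤ (TupleGame.slice i₀ G).order)
    {ℓ : Fin (n + 1) → k} {la : k} (hℓ : ℓ ≠ 0) (hla : la ≠ 0)
    (hcone : ∀ v : Fin (n + 1) → k, CobordantChart.initEval (fun _ : Fin (n + 1) => 1) v o f = la * dotProduct ℓ v ^ o)
    {L : Fin (n + 1) → k} {la' : k}
    (hcone' : ∀ w : Fin (n + 1) → k,
      CobordantChart.initEval (fun _ : Fin (n + 1) => 1) w o (TupleGame.slice i₀ G) = la' * dotProduct L w ^ o) :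
    ∃ κ : k, κ ≠ 0 ∧ ∀ j : Fin n, ℓ (i₀.succAbove j) = κ * L j.succ := by
  -- `ℓ · c = 0`: `c` is an invariance vector at a near point (N1)
  have hℓc : dotProduct ℓ c = 0 := by
    refine eq_zero_of_pow_add_eq hla ho fun a => ?_
    -- realise `a` as `ℓ · v` for some `v`: scale a coordinate where `ℓ ≠ 0`
    obtain ⟨j₁, hj₁⟩ : ∃ j₁, ℓ j₁ ≠ 0 := by
      by_contra hall; push Not at hall; exact hℓ (funext hall)
    have hv : dotProduct ℓ (Pi.single j₁ (a / ℓ j₁)) = a := by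
      rw [dotProduct_single, mul_div_cancel₀ _ hj₁]
    have h1 := initEval_add_smul_eq_of_near f c i₀ hc hfac hnear 1 (Pi.single j₁ (a / ℓ j₁))
    rw [one_smul, hcone, hcone, dotProduct_add, hv] at h1
    exact h1
  -- the transported form is non-zero
  have hℓ'' : (fun j => ℓ (i₀.succAbove j)) ≠ 0 := by
    intro h0
    apply hc
    have hsum : dotProduct ℓ c = ℓ i₀ * c i₀ := by
      rw [dotProduct, Fin.sum_univ_succAbove _ i₀]
      rw [Finset.sum_eq_zero (fun j _ => by rw [show ℓ (i₀.succAbove j) = 0 from congr_fun h0 j, zero_mul]), add_zero]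
    have hi₀ : ℓ i₀ ≠ 0 := by
      intro h1
      apply hℓ
      funext l
      rcases Fin.eq_self_or_eq_succAbove i₀ l with rfl | ⟨j, rfl⟩
      · exact h1
      · exact congr_fun h0 j
    rw [hsum] at hℓc
    exact (mul_eq_zero.mp hℓc).resolve_left hi₀
  -- nested kernels
  refine exists_smul_of_ker_le (fun u' hu' => ?_) hℓ''
  -- `(0, u′)` is an invariance vector of `in_o G′`
  have hinv : ∀ w, CobordantChart.initEval (fun _ : Fin (n + 1) => 1) (w + Fin.cons (0 : k) u') o (TupleGame.slice i₀ G) =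
      CobordantChart.initEval (fun _ : Fin (n + 1) => 1) w o (TupleGame.slice i₀ G) := by
    intro w
    rw [hcone', hcone', dotProduct_add, dotProduct_cons_zero, hu', add_zero]
  -- hence `u′♮ ∈ V(ℓ)`
  have h := insertNth_inv_of_inv_cons_zero f c i₀ hc hfac hnear hinv
  have h0 : dotProduct ℓ (Fin.insertNth i₀ (0 : k) u') = 0 := by
    refine eq_zero_of_pow_add_eq hla ho fun a => ?_
    obtain ⟨j₁, hj₁⟩ : ∃ j₁, ℓ j₁ ≠ 0 := by
      by_contra hall; push Not at hall; exact hℓ (funext hall)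
    have hv : dotProduct ℓ (Pi.single j₁ (a / ℓ j₁)) = a := by
      rw [dotProduct_single, mul_div_cancel₀ _ hj₁]
    have h1 := h (Pi.single j₁ (a / ℓ j₁))
    rw [hcone, hcone, dotProduct_add, hv] at h1
    exact h1
  rwa [dotProduct_insertNth_zero] at h0

end TOT2Near

/-! ## On decorated states: the identity point move from a state with empty history and a directrix form -/

namespace TameFourTupleDrop

open MvPowerSeries TOT2Near

variable {k : Type} [Field k] {m : ℕ}

namespace Decoration

variable {b : MvPowerSeries (Fin (m + 1)) k} {δ : Decoration k m} {c : Fin (m + 1) → k} {i : Fin (m + 1)}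

/-- With empty history `c = o` and the `I₃`-product is `f`. -/
theorem c_eq_o_of_O_eq_empty (hO : δ.O = ∅) : δ.c = δ.o := by
  rw [Decoration.c, hO, Finset.card_empty, add_zero]

/-- With empty history the `I₃`-product is `f`. -/
theorem totalO_eq_f_of_O_eq_empty (hO : δ.O = ∅) : δ.f * ∏ l ∈ δ.O, (X l : MvPowerSeries (Fin (m + 1)) k) = δ.f := by
  rw [hO, Finset.prod_empty, mul_one]

/-- At an answer where the order did not drop and the history was empty, the history stays empty. -/
theorem transform_O_eq_empty (hO : δ.O = ∅) {Φ : Fin (m + 1) → MvPowerSeries (Fin (m + 1)) k} {w : Fin (m + 1) → ℕ}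
    (heq : (δ.transform Φ w c i).o = δ.o) : (δ.transform Φ w c i).O = ∅ := by
  classical
  have hnlt : ¬ ((sqfRep (δ.strict Φ w c i)).order).toNat < δ.o := by
    rw [← Decoration.transform_o]; exact fun h => absurd heq (ne_of_lt h)
  rw [Decoration.transform_O_of_not_lt _ _ _ _ _ hnlt, hO]
  unfold newLetters
  simp

/-- The near-data package of the identity point move at a same-order answer, for the bare germ `f`. -/
theorem nearData_X (hadm : Admissible b δ) (hci : c i ≠ 0)
    (heq : (δ.transform (fun j => (X j : MvPowerSeries (Fin (m + 1)) k)) (fun _ => 1) c i).o = δ.o) :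
    subst (CobordantChart.chart (fun _ : Fin (m + 1) => 1) c) δ.f =
        X 0 ^ δ.o * satPart (δ.fChart (fun j => (X j : MvPowerSeries (Fin (m + 1)) k)) (fun _ => 1) c) ∧
      ((δ.o : ℕ) : ℕ∞) ≤ (TupleGame.slice i (satPart (δ.fChart (fun j => (X j : MvPowerSeries (Fin (m + 1)) k)) (fun _ => 1) c))).order ∧
      (δ.transform (fun j => (X j : MvPowerSeries (Fin (m + 1)) k)) (fun _ => 1) c i).f =
        TupleGame.slice i (satPart (δ.fChart (fun j => (X j : MvPowerSeries (Fin (m + 1)) k)) (fun _ => 1) c)) := by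
  have hf : δ.f ≠ 0 := hadm.2.1.ne_zero
  have hperm := isBPermissible_point_X (k := k) δ
  have hc0 : ∀ l : Fin (m + 1), (fun _ : Fin (m + 1) => (1 : ℕ)) l = 0 → c l = 0 := fun l hl => absurd hl one_ne_zero
  obtain ⟨hfac, -, hnear⟩ := Decoration.nearData_of_o_transform_eq hperm hc0 hf hci heq
  rw [TOT2E1.subst_X_fun] at hfac
  exact ⟨hfac, hnear, Decoration.transform_f_eq_strict_of_o_transform_eq hperm hc0 hf hci heq⟩

/-- **`ℓ · c = 0` AT A SAME-ORDER ANSWER**: the near answers of the identity point move from a state with empty history and directrix form `ℓ` lie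
on the directrix plane. -/
theorem dot_eq_zero_of_near [Infinite k] (hadm : Admissible b δ) (ho : 2 ≤ δ.o) (hO : δ.O = ∅) {ℓ : Fin (m + 1) → k} (hℓ : δ.IsDirForm ℓ)
    (hci : c i ≠ 0) (heq : (δ.transform (fun j => (X j : MvPowerSeries (Fin (m + 1)) k)) (fun _ => 1) c i).o = δ.o) :
    dotProduct ℓ c = 0 := by
  obtain ⟨hfac, hnear, -⟩ := nearData_X hadm hci heq
  obtain ⟨hℓ0, la, hla, hcone⟩ := hℓ
  rw [c_eq_o_of_O_eq_empty hO, totalO_eq_f_of_O_eq_empty hO] at hcone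
  refine eq_zero_of_pow_add_eq (o := δ.o) hla (by omega) fun a => ?_
  obtain ⟨j₁, hj₁⟩ : ∃ j₁, ℓ j₁ ≠ 0 := by
    by_contra hall; push Not at hall; exact hℓ0 (funext hall)
  have hv : dotProduct ℓ (Pi.single j₁ (a / ℓ j₁)) = a := by
    rw [dotProduct_single, mul_div_cancel₀ _ hj₁]
  have h1 := initEval_add_smul_eq_of_near δ.f c i hci hfac hnear 1 (Pi.single j₁ (a / ℓ j₁))
  rw [one_smul, hcone, hcone, dotProduct_add, hv] at h1
  exact h1

/-- **DIRECTRIX TRANSPORT ON DECORATED STATES.**  From an admissible state with `2 ≤ o`, empty history and directrix form `ℓ`, at an answer `(c, i)`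
of the identity point move with the SAME order, every directrix form `L` of the transform has tail proportional (non-zero factor) to the transported
`ℓ`: `ℓ (i.succAbove j) = κ · L j.succ`. -/
theorem tail_dirForm_transform [Infinite k] (hadm : Admissible b δ) (ho : 2 ≤ δ.o) (hO : δ.O = ∅) {ℓ : Fin (m + 1) → k}
    (hℓ : δ.IsDirForm ℓ) (hci : c i ≠ 0)
    (heq : (δ.transform (fun j => (X j : MvPowerSeries (Fin (m + 1)) k)) (fun _ => 1) c i).o = δ.o) {L : Fin (m + 1) → k}
    (hL : (δ.transform (fun j => (X j : MvPowerSeries (Fin (m + 1)) k)) (fun _ => 1) c i).IsDirForm L) :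
    ∃ κ : k, κ ≠ 0 ∧ ∀ j : Fin m, ℓ (i.succAbove j) = κ * L j.succ := by
  cases m with
  | zero => exact ⟨1, one_ne_zero, fun j => j.elim0⟩
  | succ n =>
    obtain ⟨hfac, hnear, hf'⟩ := nearData_X hadm hci heq
    obtain ⟨hℓ0, la, hla, hcone⟩ := hℓ
    rw [c_eq_o_of_O_eq_empty hO, totalO_eq_f_of_O_eq_empty hO] at hcone
    obtain ⟨-, la', -, hcone'⟩ := hL
    rw [c_eq_o_of_O_eq_empty (transform_O_eq_empty hO heq), totalO_eq_f_of_O_eq_empty (transform_O_eq_empty hO heq), heq, hf']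
      at hcone'
    exact tail_dirForm_of_near δ.f c i hci (by omega) hfac hnear hℓ0 hla hcone hcone'

/-- The boundary of the transform under the identity point move: the new exceptional letter `0` and the through-going letters re-indexed. -/
theorem mem_transform_E_X_iff (l' : Fin (m + 1)) :
    l' ∈ (δ.transform (fun j => (X j : MvPowerSeries (Fin (m + 1)) k)) (fun _ => 1) c i).E ↔
      l' = 0 ∨ ∃ l ∈ δ.E, c l = 0 ∧ Fin.predAbove i l.succ = l' := by
  classical
  rw [Decoration.transform_E, Finset.mem_insert]
  unfold newLetters
  simp only [Finset.mem_image, Finset.mem_filter, TOT2E1.strIdx_X]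
  constructor
  · rintro (h | ⟨l, ⟨hl, hc⟩, he⟩)
    · exact Or.inl h
    · exact Or.inr ⟨l, hl, hc, he⟩
  · rintro (h | ⟨l, hl, hc, he⟩)
    · exact Or.inl h
    · exact Or.inr ⟨l, ⟨hl, hc⟩, he⟩

/-- The successor index of a through-going coordinate `i.succAbove j` is `j.succ`; at an answer with live slot `i` (`c_i ≠ 0`) it is a boundary
letter of the transform iff the coordinate was a boundary letter passing through the new point (`c = 0` there). -/
theorem succ_mem_transform_E_X_iff (hci : c i ≠ 0) (j : Fin m) :
    (j.succ : Fin (m + 1)) ∈ (δ.transform (fun j => (X j : MvPowerSeries (Fin (m + 1)) k)) (fun _ => 1) c i).E ↔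
      i.succAbove j ∈ δ.E ∧ c (i.succAbove j) = 0 := by
  rw [mem_transform_E_X_iff]
  constructor
  · rintro (h | ⟨l, hl, hc, he⟩)
    · exact absurd h (Fin.succ_ne_zero j)
    · rcases Fin.eq_self_or_eq_succAbove i l with rfl | ⟨j', rfl⟩
      · exact absurd hc hci
      · rw [TOT2Near.predAbove_succ_succAbove_succ] at he
        cases Fin.succ_injective _ he
        exact ⟨hl, hc⟩
  · rintro ⟨hl, hc⟩
    exact Or.inr ⟨i.succAbove j, hl, hc, TOT2Near.predAbove_succ_succAbove_succ i j⟩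

/-- The new exceptional letter `0` is a boundary letter of the transform. -/
theorem zero_mem_transform_E_X :
    (0 : Fin (m + 1)) ∈ (δ.transform (fun j => (X j : MvPowerSeries (Fin (m + 1)) k)) (fun _ => 1) c i).E :=
  (mem_transform_E_X_iff 0).mpr (Or.inl rfl)

/-! ## Regime read-outs at a same-order answer -/

/-- **(L-EXIT) FROM THE LETTER REGIME THE DIRECTRIX STAYS ON THE LETTER OR TILTS INTO BAD POSITION.**  From an admissible state with `2 ≤ o` in the
letter regime `LetterDir δ l` (`O = ∅`, `in_o f = λ·x_l^o`, `x_l` a boundary letter), at an answer `(c, i)` of the identity point move with the same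
order, if the transform has a directrix form `L` then: `L 0 = 0` and the transform is again in the letter regime for the transformed letter, or
`L 0 ≠ 0` and the transform is in BAD position (its directrix form is carried by the transformed letter and the new exceptional letter `0`). -/
theorem letterDir_or_badDir_transform [Infinite k] (hadm : Admissible b δ) (ho : 2 ≤ δ.o) {l : Fin (m + 1)} (hl : δ.LetterDir l)
    (hci : c i ≠ 0) (heq : (δ.transform (fun j => (X j : MvPowerSeries (Fin (m + 1)) k)) (fun _ => 1) c i).o = δ.o)
    {L : Fin (m + 1) → k} (hL : (δ.transform (fun j => (X j : MvPowerSeries (Fin (m + 1)) k)) (fun _ => 1) c i).IsDirForm L) :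
    (∃ l', (δ.transform (fun j => (X j : MvPowerSeries (Fin (m + 1)) k)) (fun _ => 1) c i).LetterDir l') ∨
      (δ.transform (fun j => (X j : MvPowerSeries (Fin (m + 1)) k)) (fun _ => 1) c i).BadDir := by
  classical
  obtain ⟨hO, hlE, hdir⟩ := hl
  set δ' := δ.transform (fun j => (X j : MvPowerSeries (Fin (m + 1)) k)) (fun _ => 1) c i with hδ'
  have hO' : δ'.O = ∅ := transform_O_eq_empty hO heq
  -- the letter passes through the new point: `c_l = 0`, hence `l ≠ i`
  have hcl : c l = 0 := by
    have h := dot_eq_zero_of_near hadm ho hO hdir hci heq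
    rwa [single_one_dotProduct] at h
  have hli : l ≠ i := fun h => hci (h ▸ hcl)
  obtain ⟨j₀, hj₀⟩ := Fin.exists_succAbove_eq hli
  -- the tail of `L` is the transported `e_l`
  obtain ⟨κ, hκ, htail⟩ := tail_dirForm_transform hadm ho hO hdir hci heq hL
  have hLj₀ : L j₀.succ ≠ 0 := by
    have h := htail j₀
    rw [hj₀, Pi.single_eq_same] at h
    intro h0
    rw [h0, mul_zero] at h
    exact one_ne_zero h
  have hLj : ∀ j, j ≠ j₀ → L j.succ = 0 := by
    intro j hj
    have h := htail j
    rw [Pi.single_eq_of_ne (fun h' => hj (Fin.succAbove_right_injective (h'.trans hj₀.symm))), eq_comm, mul_eq_zero] at h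
    exact h.resolve_left hκ
  have hmem : (j₀.succ : Fin (m + 1)) ∈ δ'.E := (succ_mem_transform_E_X_iff hci j₀).mpr ⟨hj₀ ▸ hlE, hj₀ ▸ hcl⟩
  by_cases hL0 : L 0 = 0
  · left
    refine ⟨j₀.succ, hO', hmem, isDirForm_single_of_support hL fun j' hj' => ?_⟩
    refine Fin.cases (fun _ => hL0) (fun j hj => ?_) j' hj'
    exact hLj j fun h => hj (by rw [h])
  · right
    refine ⟨hO', L, hL, fun j' hj' => ?_, 0, j₀.succ, (Fin.succ_ne_zero j₀).symm, hL0, hLj₀⟩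
    refine Fin.cases (fun _ => zero_mem_transform_E_X) (fun j hj => ?_) j' hj'
    by_cases hjj : j = j₀
    · rw [hjj]; exact hmem
    · exact absurd (hLj j hjj) hj

/-- **(B-EXIT) A LEAVING LETTER OF THE DIRECTRIX FORM PUTS THE LETTERS IN GOOD POSITION.**  From an admissible state with `2 ≤ o`, empty history and
directrix form `ℓ`, at an answer `(c, i)` of the identity point move with the same order at which some coordinate `l₁` of the support of `ℓ` LEAVES
(`c_{l₁} ≠ 0`; then another one leaves too, as `ℓ·c = 0`), every directrix form `L` of the transform involves a coordinate that is not a boundary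
letter: the transform is in GOOD position. -/
theorem goodDir_transform_of_leaving [Infinite k] (hadm : Admissible b δ) (ho : 2 ≤ δ.o) (hO : δ.O = ∅) {ℓ : Fin (m + 1) → k}
    (hℓ : δ.IsDirForm ℓ) {l₁ : Fin (m + 1)} (hl₁ : ℓ l₁ ≠ 0) (hc₁ : c l₁ ≠ 0) (hci : c i ≠ 0)
    (heq : (δ.transform (fun j => (X j : MvPowerSeries (Fin (m + 1)) k)) (fun _ => 1) c i).o = δ.o)
    {L : Fin (m + 1) → k} (hL : (δ.transform (fun j => (X j : MvPowerSeries (Fin (m + 1)) k)) (fun _ => 1) c i).IsDirForm L) :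
    (δ.transform (fun j => (X j : MvPowerSeries (Fin (m + 1)) k)) (fun _ => 1) c i).GoodDir := by
  classical
  set δ' := δ.transform (fun j => (X j : MvPowerSeries (Fin (m + 1)) k)) (fun _ => 1) c i with hδ'
  have hO' : δ'.O = ∅ := transform_O_eq_empty hO heq
  -- a leaving coordinate of the support off the live slot
  obtain ⟨j₂, hℓ₂, hc₂⟩ : ∃ j₂ : Fin m, ℓ (i.succAbove j₂) ≠ 0 ∧ c (i.succAbove j₂) ≠ 0 := by
    rcases Fin.eq_self_or_eq_succAbove i l₁ with rfl | ⟨j, rfl⟩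
    · -- the live slot leaves: some other support coordinate leaves too
      have h0 := dot_eq_zero_of_near hadm ho hO hℓ hci heq
      rw [dotProduct, Fin.sum_univ_succAbove _ l₁] at h0
      have hne : ∑ j : Fin m, ℓ (l₁.succAbove j) * c (l₁.succAbove j) ≠ 0 := by
        intro hs
        rw [hs, add_zero] at h0
        exact (mul_ne_zero hl₁ hc₁) h0
      obtain ⟨j, -, hj⟩ := Finset.exists_ne_zero_of_sum_ne_zero hne
      exact ⟨j, left_ne_zero_of_mul hj, right_ne_zero_of_mul hj⟩
    · exact ⟨j, hl₁, hc₁⟩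
  obtain ⟨κ, hκ, htail⟩ := tail_dirForm_transform hadm ho hO hℓ hci heq hL
  refine ⟨hO', L, hL, j₂.succ, fun hmem => ?_, fun h0 => ?_⟩
  · exact hc₂ ((succ_mem_transform_E_X_iff hci j₂).mp hmem).2
  · have h := htail j₂
    rw [h0, mul_zero] at h
    exact hℓ₂ h

/-- **(L-EXIT), THREE LETTERS**: the transform at a same-order answer, if admissibly decorating the successor, is in the apex column, or in the
letter regime, or in bad position. -/
theorem letter_exit [Infinite k] {b : MvPowerSeries (Fin (2 + 1)) k} {δ : Decoration k 2} {c : Fin (2 + 1) → k} {i : Fin (2 + 1)}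
    (hadm : Admissible b δ) (ho : 2 ≤ δ.o) {l : Fin (2 + 1)} (hl : δ.LetterDir l) (hci : c i ≠ 0)
    (heq : (δ.transform (fun j => (X j : MvPowerSeries (Fin (2 + 1)) k)) (fun _ => 1) c i).o = δ.o)
    {b' : MvPowerSeries (Fin (2 + 1)) k}
    (hadm' : Admissible b' (δ.transform (fun j => (X j : MvPowerSeries (Fin (2 + 1)) k)) (fun _ => 1) c i)) :
    (δ.transform (fun j => (X j : MvPowerSeries (Fin (2 + 1)) k)) (fun _ => 1) c i).HCol ∨
      (∃ l', (δ.transform (fun j => (X j : MvPowerSeries (Fin (2 + 1)) k)) (fun _ => 1) c i).LetterDir l') ∨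
      (δ.transform (fun j => (X j : MvPowerSeries (Fin (2 + 1)) k)) (fun _ => 1) c i).BadDir := by
  by_cases hc' : (δ.transform (fun j => (X j : MvPowerSeries (Fin (2 + 1)) k)) (fun _ => 1) c i).HCol
  · exact Or.inl hc'
  · obtain ⟨L, hL⟩ := exists_isDirForm_of_not_hCol hadm' (heq ▸ ho) hc'
    exact Or.inr (letterDir_or_badDir_transform hadm ho hl hci heq hL)

/-- **(B-EXIT), THREE LETTERS**: if a support coordinate of the directrix form leaves at a same-order answer, the transform (admissibly decorating
the successor) is in the apex column or in good position. -/
theorem bad_exit [Infinite k] {b : MvPowerSeries (Fin (2 + 1)) k} {δ : Decoration k 2} {c : Fin (2 + 1) → k} {i : Fin (2 + 1)}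
    (hadm : Admissible b δ) (ho : 2 ≤ δ.o) (hO : δ.O = ∅) {ℓ : Fin (2 + 1) → k} (hℓ : δ.IsDirForm ℓ) {l₁ : Fin (2 + 1)}
    (hl₁ : ℓ l₁ ≠ 0) (hc₁ : c l₁ ≠ 0) (hci : c i ≠ 0)
    (heq : (δ.transform (fun j => (X j : MvPowerSeries (Fin (2 + 1)) k)) (fun _ => 1) c i).o = δ.o)
    {b' : MvPowerSeries (Fin (2 + 1)) k}
    (hadm' : Admissible b' (δ.transform (fun j => (X j : MvPowerSeries (Fin (2 + 1)) k)) (fun _ => 1) c i)) :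
    (δ.transform (fun j => (X j : MvPowerSeries (Fin (2 + 1)) k)) (fun _ => 1) c i).HCol ∨
      (δ.transform (fun j => (X j : MvPowerSeries (Fin (2 + 1)) k)) (fun _ => 1) c i).GoodDir := by
  by_cases hc' : (δ.transform (fun j => (X j : MvPowerSeries (Fin (2 + 1)) k)) (fun _ => 1) c i).HCol
  · exact Or.inl hc'
  · obtain ⟨L, hL⟩ := exists_isDirForm_of_not_hCol hadm' (heq ▸ ho) hc'
    exact Or.inr (goodDir_transform_of_leaving hadm ho hO hℓ hl₁ hc₁ hci heq hL)

end Decoration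

end TameFourTupleDrop

end Summit.ResolutionOfSingularities.ResolutionOfSingularities.Theorems

end
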